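import Literature.NumberTheory.Transcendental.ExpPointsDegenerateSections
import Literature.NumberTheory.Transcendental.LogLatticeCurveRigidity
import Literature.RingTheory.Nullstellensatz.RationalPointsSpan
import HarnessLib

/-!
# Independent exponential points on `ℚ`-curves of `ℂ² × ℂ²`: the constant-exponential class

Second of the two "classical classes" (companion of
`Literature.NumberTheory.Transcendental.finite_indepExpPoints_section`): for `W ⊆ ℂ² × ℂ²`
defined over `ℚ` with `dim W < 2` and **any** `ω ∈ ℂ²`, only finitely many `ℚ`-linearly
independent `x` with `(x, eˣ) ∈ W` have `eˣ = ω` (`finite_indepExpPoints_fibre`).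

Proof. Suppose infinitely many. Then `ω ∈ (ℂˣ)²`; fix logarithms `u` (`e^{uⱼ} = ωⱼ`), so every
such `x` is `u + 2πi n`, `n ∈ ℤ²`. The graph points accumulate on an irreducible curve
`C = Z(P) ⊆ W ∩ {y = ω}`; since `yⱼ ≡ ωⱼ` on `C` is a `ℚ`-rational function of the generic point of
`C`, `ωⱼ` is algebraic (`isAlgebraic_of_rel_mem`), and two `x`-coordinates of the generic point are
algebraically dependent over `ℚ` (`exists_rat_poly_rename_mem`): a non-zero `R ∈ ℚ[z, w]` vanishes
on the plane curve `D = {x : (x, ω) ∈ C}`, whose prime `P_D` is therefore generated by an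
absolutely irreducible factor `G ∈ ℚ̄[z, w]` of `R`
(`Literature.RingTheory.Nullstellensatz.prime_map_of_isAlgClosed`, and `dim ℂ[z, w] = 2`). The
integer points `n` with `u + 2πi n ∈ D` are Zariski dense in the curve `(D - u)/2πi`, which is thus
defined over `ℚ`: `G(u + 2πi V) = κ S(V)` with `S ∈ ℚ[V]`
(`Literature.RingTheory.Nullstellensatz.exists_eq_C_mul_map_of_forall_dvd`). The rigidity theorem
`Literature.NumberTheory.Transcendental.LogLattice.not_linearIndependent_of_bind₁_affine_eq`
(Hermite–Lindemann and Lindemann only) then says that every point `u + 2πi n` of `D` is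
`ℚ`-linearly dependent — contradiction.
-/

noncomputable section

open MvPolynomial Complex
open scoped Real

namespace Literature.NumberTheory.Transcendental

/-- **Fibres of the exponential carry finitely many independent exponential points.** For
`W ⊆ ℂ² × ℂ²` defined over `ℚ` with `dim W < 2` and any `ω ∈ ℂ²`, the set of
`x ∈ indepExpPoints W` with `eˣ = ω` is finite. [cite: Lindemann1882] -/
theorem finite_indepExpPoints_fibre (W : Set (Fin 2 ⊕ Fin 2 → ℂ))
    (hW : IsDefinedOver (⊥ : Subfield ℂ) W) (hdim : zariskiDim ℂ W < 2) (ω : Fin 2 → ℂ) :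
    Set.Finite {x : Fin 2 → ℂ | x ∈ indepExpPoints W ∧ Complex.exp ∘ x = ω} := by
  classical
  by_contra hinf
  rw [← Set.not_infinite, not_not] at hinf
  set Hx := {x : Fin 2 → ℂ | x ∈ indepExpPoints W ∧ Complex.exp ∘ x = ω} with hHx
  -- `ω` has non-zero coordinates; fix logarithms
  have hω : ∀ j, ω j ≠ 0 := by
    intro j hj
    obtain ⟨x, hx⟩ := hinf.nonempty
    have := congrFun hx.2 j
    simp only [Function.comp_apply] at this
    exact Complex.exp_ne_zero (x j) (this.trans hj)
  set u : Fin 2 → ℂ := fun j => Complex.log (ω j) with hu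
  have hexpu : ∀ j, Complex.exp (u j) = ω j := fun j => Complex.exp_log (hω j)
  have hpt : ∀ x ∈ Hx, ∃ n : Fin 2 → ℤ, ∀ j, x j = u j + n j * (2 * (Real.pi : ℂ) * I) := by
    intro x hx
    have h1 : ∀ j, ∃ n : ℤ, x j = u j + n * (2 * (Real.pi : ℂ) * I) := fun j =>
      Complex.exp_eq_exp_iff_exists_int.1 (by
        rw [hexpu]
        have := congrFun hx.2 j
        simpa using this)
    choose n hn using h1
    exact ⟨n, hn⟩
  -- the ideal over `ℚ`, the graph points and a component
  obtain ⟨J, hWJ⟩ := exists_ideal_rat_of_isDefinedOver_bot hW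
  have hdim1 := ringKrullDim_le_one_of_zariskiDim_lt_two hdim hWJ
  set graph : (Fin 2 → ℂ) → (Fin 2 ⊕ Fin 2 → ℂ) := fun x => Sum.elim x (Complex.exp ∘ x)
    with hgraph
  set H : Set (Fin 2 ⊕ Fin 2 → ℂ) := graph '' Hx with hH
  have hHinf : H.Infinite := hinf.image graph_injective.injOn
  obtain ⟨P, hPprime, hIP, hPmax, hPinf⟩ := exists_prime_infinite_inter_zeroLocus hHinf
  have hHW : ∀ z ∈ H, z ∈ W := by
    rintro z ⟨x, hx, rfl⟩
    exact hx.1.2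
  have hJP : ∀ f ∈ J, MvPolynomial.map (algebraMap ℚ ℂ) f ∈ P := by
    intro f hf
    refine hIP ((mem_vanishingIdeal_iff).2 fun z hz => ?_)
    rw [aeval_map_algebraMap]
    have hzW := hHW z hz
    rw [hWJ] at hzW
    exact (mem_zeroLocus_iff.1 hzW) f hf
  -- `ω` is algebraic
  have hωalg : ∀ j, IsAlgebraic ℚ (ω j) := by
    intro j
    refine isAlgebraic_of_rel_mem hdim1 hJP hPmax (ω j) (X (Sum.inr j)) 1 ?_ ?_
    · rw [map_one]
      exact (Ideal.ne_top_iff_one P).1 hPprime.ne_top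
    · refine hIP ((mem_vanishingIdeal_iff).2 ?_)
      rintro z ⟨x, hx, rfl⟩
      have hxj : Complex.exp (x j) = ω j := by
        have := congrFun hx.2 j
        simpa using this
      simp only [map_sub, map_one, aeval_C, map_X, aeval_X, hgraph, Sum.elim_inr,
        Function.comp_apply, Algebra.algebraMap_self, RingHom.id_apply, mul_one, hxj, sub_self]
  have hualg : ∀ j, IsAlgebraic ℚ (Complex.exp (u j)) := fun j => by
    rw [hexpu]
    exact hωalg j
  -- a rational polynomial in the `x`-coordinates vanishing on the component
  obtain ⟨R, hR0, hRP⟩ := exists_rat_poly_rename_mem hdim1 hJP Sum.inl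
  -- the plane prime `Pp = {r : r(X₀, X₁) ∈ P}`
  set Pp : Ideal (MvPolynomial (Fin 2) ℂ) :=
    P.comap (rename Sum.inl : MvPolynomial (Fin 2) ℂ →ₐ[ℂ] MvPolynomial (Fin 2 ⊕ Fin 2) ℂ)
    with hPp
  haveI hPpprime : Pp.IsPrime := Ideal.IsPrime.comap _
  set Rℂ : MvPolynomial (Fin 2) ℂ := MvPolynomial.map (algebraMap ℚ ℂ) R with hRℂ
  have hRℂP : Rℂ ∈ Pp := Ideal.mem_comap.2 hRP
  have hRℂ0 : Rℂ ≠ 0 := fun h =>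
    hR0 (map_injective _ (algebraMap ℚ ℂ).injective (by rw [← hRℂ, h, map_zero]))
  have hPp0 : Pp ≠ ⊥ := fun h => hRℂ0 (by simpa [h] using hRℂP)
  -- the points of `Hx` on the component
  set Hx' : Set (Fin 2 → ℂ) := {x ∈ Hx | graph x ∈ zeroLocus ℂ P} with hHx'
  have hHx'inf : Hx'.Infinite := by
    have heq : H ∩ zeroLocus ℂ P = graph '' Hx' := by
      ext z
      constructor
      · rintro ⟨⟨x, hx, rfl⟩, hz⟩
        exact ⟨x, ⟨hx, hz⟩, rfl⟩
      · rintro ⟨x, ⟨hx, hz⟩, rfl⟩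
        exact ⟨⟨x, hx, rfl⟩, hz⟩
    rw [heq] at hPinf
    exact Set.Infinite.of_image _ hPinf
  have hZ : ∀ x ∈ Hx', x ∈ zeroLocus ℂ Pp := by
    intro x hx
    rw [mem_zeroLocus_iff]
    intro r hr
    have hr' := (mem_zeroLocus_iff.1 hx.2) _ (Ideal.mem_comap.1 hr)
    rw [aeval_rename] at hr'
    have hcomp : (graph x ∘ Sum.inl) = x := by
      funext j
      simp [hgraph]
    rwa [hcomp] at hr'
  have hPpmax : ¬ Pp.IsMaximal := by
    obtain ⟨x, hx, y, hy, hxy⟩ := hHx'inf.nontrivial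
    exact not_isMaximal_of_mem_zeroLocus_of_ne (hZ x hx) (hZ y hy) hxy
  -- an absolutely irreducible factor of `R` generating `Pp`
  haveI : IsAlgClosed (algebraicClosure ℚ ℂ) := (algebraicClosure.isAlgClosure ℚ ℂ).isAlgClosed
  set K₁ := algebraicClosure ℚ ℂ with hK₁
  set R₁ : MvPolynomial (Fin 2) K₁ := MvPolynomial.map (algebraMap ℚ K₁) R with hR₁
  have hR₁0 : R₁ ≠ 0 := fun h =>
    hR0 (map_injective _ (algebraMap ℚ K₁).injective (by rw [← hR₁, h, map_zero]))
  have hmapR₁ : MvPolynomial.map (algebraMap K₁ ℂ) R₁ = Rℂ := by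
    rw [hR₁, map_map, ← IsScalarTower.algebraMap_eq, hRℂ]
  obtain ⟨uu, huu⟩ := UniqueFactorizationMonoid.factors_prod hR₁0
  have hprodP : ((UniqueFactorizationMonoid.factors R₁).map
      (MvPolynomial.map (algebraMap K₁ ℂ))).prod ∈ Pp := by
    have h1 : MvPolynomial.map (algebraMap K₁ ℂ) ((UniqueFactorizationMonoid.factors R₁).prod) *
        MvPolynomial.map (algebraMap K₁ ℂ) (uu : MvPolynomial (Fin 2) K₁) ∈ Pp := by
      rw [← map_mul, huu, hmapR₁]
      exact hRℂP
    rw [map_multiset_prod] at h1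
    rcases hPpprime.mem_or_mem h1 with h | h
    · exact h
    · exfalso
      have hunit : IsUnit (MvPolynomial.map (algebraMap K₁ ℂ) (uu : MvPolynomial (Fin 2) K₁)) :=
        (Units.isUnit uu).map _
      exact hPpprime.ne_top (Ideal.eq_top_of_isUnit_mem _ h hunit)
  obtain ⟨G, hGmem, hGP⟩ := (hPpprime.multiset_prod_mem_iff_exists_mem _).1 hprodP
  obtain ⟨p₁, hp₁, rfl⟩ := Multiset.mem_map.1 hGmem
  have hp₁prime : Prime p₁ := UniqueFactorizationMonoid.prime_of_factor p₁ hp₁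
  have hGprime : Prime (MvPolynomial.map (algebraMap K₁ ℂ) p₁) :=
    Literature.RingTheory.Nullstellensatz.prime_map_of_isAlgClosed hp₁prime
  set G := MvPolynomial.map (algebraMap K₁ ℂ) p₁ with hG
  have hG0 : G ≠ 0 := hGprime.ne_zero
  have hPpG : Pp = Ideal.span {G} := by
    have hspan_prime : (Ideal.span {G}).IsPrime := (Ideal.span_singleton_prime hG0).2 hGprime
    have hle : Ideal.span {G} ≤ Pp := (Ideal.span_singleton_le_iff_mem _).2 hGP
    by_contra hne
    have hlt : Ideal.span {G} < Pp := lt_of_le_of_ne hle (Ne.symm hne)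
    have hbot : Ideal.span {G} ≠ ⊥ := by
      rw [Ne, Ideal.span_singleton_eq_bot]
      exact hG0
    exact hPpmax (isMaximal_of_bot_lt_of_lt hbot hlt)
  have hGalg : ∀ m, IsAlgebraic ℚ (G.coeff m) := by
    intro m
    rw [hG, coeff_map]
    exact mem_algebraicClosure_iff.1 (p₁.coeff m).2
  -- the rational points `w` with `u + 2πi w ∈ Hx'`
  set Vset : Set (Fin 2 → ℚ) := {w | (fun j => u j + (2 * (Real.pi : ℂ) * I) * w j) ∈ Hx'}
    with hVset
  have hV : ∀ x ∈ Hx', ∃ w ∈ Vset, (fun j => u j + (2 * (Real.pi : ℂ) * I) * w j) = x := by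
    intro x hx
    obtain ⟨n, hn⟩ := hpt x hx.1
    have hx' : (fun j => u j + (2 * (Real.pi : ℂ) * I) * ((n j : ℚ) : ℂ)) = x := by
      funext j
      rw [hn j]
      push_cast
      ring
    refine ⟨fun j => (n j : ℚ), ?_, hx'⟩
    show (fun j => u j + (2 * (Real.pi : ℂ) * I) * ((n j : ℚ) : ℂ)) ∈ Hx'
    rw [hx']
    exact hx
  have hVinf : Vset.Infinite := by
    intro hfin
    apply hHx'inf
    refine (hfin.image fun w : Fin 2 → ℚ => fun j => u j + (2 * (Real.pi : ℂ) * I) * w j).subset ?_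
    intro x hx
    obtain ⟨w, hw, hwx⟩ := hV x hx
    exact ⟨w, hw, hwx⟩
  -- the affine substitution and its inverse
  have hc0 : (2 * (Real.pi : ℂ) * I) ≠ 0 := Complex.two_pi_I_ne_zero
  set θ : MvPolynomial (Fin 2) ℂ →ₐ[ℂ] MvPolynomial (Fin 2) ℂ :=
    bind₁ (fun i => C (u i) + C (2 * (Real.pi : ℂ) * I) * X i) with hθ
  set ψ : Fin 2 → MvPolynomial (Fin 2) ℂ :=
    fun i => C (2 * (Real.pi : ℂ) * I)⁻¹ * (X i - C (u i)) with hψ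
  have hθψ : ∀ p : MvPolynomial (Fin 2) ℂ, θ (bind₁ ψ p) = p := by
    intro p
    rw [hθ, bind₁_bind₁]
    have key : (fun i => bind₁ (fun i => C (u i) + C (2 * (Real.pi : ℂ) * I) * X i) (ψ i)) = X := by
      funext i
      simp only [hψ]
      rw [map_mul, map_sub, bind₁_C_right, bind₁_X_right, bind₁_C_right]
      have hcc : C (2 * (Real.pi : ℂ) * I)⁻¹ * C (2 * (Real.pi : ℂ) * I) =
          (1 : MvPolynomial (Fin 2) ℂ) := by
        rw [← map_mul, inv_mul_cancel₀ hc0, map_one]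
      linear_combination (X i) * hcc
    rw [key, bind₁_X_left, AlgHom.id_apply]
  have heval : ∀ (y : Fin 2 → ℂ) (p : MvPolynomial (Fin 2) ℂ), aeval y p = MvPolynomial.eval y p :=
    fun _ _ => rfl
  -- `θ G` vanishes at the rational points
  have hfA : ∀ w ∈ Vset, aeval (fun i => algebraMap ℚ ℂ (w i)) (θ G) = 0 := by
    intro w hw
    rw [heval, hθ, Literature.Algebra.Polynomial.eval_bind₁_affine]
    have hmem := hZ _ hw
    have := (mem_zeroLocus_iff.1 hmem) G (hPpG ▸ Ideal.mem_span_singleton_self G)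
    rw [heval] at this
    have hF : (fun i => u i + 2 * (Real.pi : ℂ) * I * algebraMap ℚ ℂ (w i)) =
        fun j => u j + 2 * (Real.pi : ℂ) * I * (w j : ℂ) := by
      funext j
      rw [eq_ratCast]
    rw [hF]
    exact this
  -- `θ G` divides every polynomial vanishing at the rational points
  have hBP : vanishingIdeal ℂ Hx' = Pp := by
    have hle : Pp ≤ vanishingIdeal ℂ Hx' := by
      intro r hr
      rw [mem_vanishingIdeal_iff]
      intro x hx
      exact (mem_zeroLocus_iff.1 (hZ x hx)) r hr
    by_contra hne
    have hne' : ¬ vanishingIdeal ℂ Hx' ≤ Pp := fun h => hne (le_antisymm h hle)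
    obtain ⟨b, hb, hbP⟩ := Set.not_subset.1 hne'
    obtain ⟨P'', hP''prime, hIP'', hP''max, -⟩ := exists_prime_infinite_inter_zeroLocus hHx'inf
    haveI := hP''prime
    have hlt : Pp < P'' := by
      refine lt_of_le_of_ne (hle.trans hIP'') ?_
      intro heq
      exact hbP (heq ▸ hIP'' hb)
    exact hP''max (isMaximal_of_bot_lt_of_lt hPp0 hlt)
  have hdvd : ∀ p : MvPolynomial (Fin 2) ℂ,
      (∀ w ∈ Vset, aeval (fun i => algebraMap ℚ ℂ (w i)) p = 0) → θ G ∣ p := by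
    intro p hp
    have hp₁ : bind₁ ψ p ∈ vanishingIdeal ℂ Hx' := by
      rw [mem_vanishingIdeal_iff]
      intro x hx
      obtain ⟨w, hw, hwx⟩ := hV x hx
      rw [heval, LogLattice.eval_bind₁]
      have key : (fun i => MvPolynomial.eval x (ψ i)) = fun i => algebraMap ℚ ℂ (w i) := by
        funext i
        rw [← hwx]
        simp only [hψ, map_mul, eval_C, map_sub, eval_X, eq_ratCast]
        field_simp
        ring
      rw [key, ← heval]
      exact hp w hw
    rw [hBP, hPpG, Ideal.mem_span_singleton] at hp₁
    obtain ⟨h, hh⟩ := hp₁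
    refine ⟨θ h, ?_⟩
    rw [← map_mul, ← hh, hθψ]
  have hθG0 : θ G ≠ 0 := by
    intro h0
    apply hG0
    exact Literature.Algebra.Polynomial.bind₁_affine_injective u hc0 (by rw [← hθ, h0, map_zero])
  obtain ⟨κ, S₁, hκ0, -, -, hGS⟩ :=
    Literature.RingTheory.Nullstellensatz.exists_eq_C_mul_map_of_forall_dvd Vset hθG0 hfA hdvd
  -- rigidity at one point of `Hx'`
  obtain ⟨x, hx⟩ := hHx'inf.nonempty
  obtain ⟨w, hw, hwx⟩ := hV x hx
  have hSrat : ∀ m, ∃ q : ℚ, (MvPolynomial.map (algebraMap ℚ ℂ) S₁).coeff m = q := fun m =>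
    ⟨S₁.coeff m, by rw [coeff_map, eq_ratCast]⟩
  have hvG : MvPolynomial.eval (fun j => u j + 2 * (Real.pi : ℂ) * I * w j) G = 0 := by
    have hmem := hZ _ hw
    have := (mem_zeroLocus_iff.1 hmem) G (hPpG ▸ Ideal.mem_span_singleton_self G)
    rw [heval] at this
    convert this using 2
  have hdep := LogLattice.not_linearIndependent_of_bind₁_affine_eq hualg G
    (MvPolynomial.map (algebraMap ℚ ℂ) S₁) hGalg hSrat hG0 (by rw [← hθ]; exact hGS) w hvG
  apply hdep
  have hli : LinearIndependent ℚ x := hx.1.1.1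
  rw [hwx]
  exact hli

end Literature.NumberTheory.Transcendental
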